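import Summits.ResolutionOfSingularities.ResolutionOfSingularities.Theorems.HomologicalConductorNoZenoNewCurvesContracted
import Summits.ResolutionOfSingularities.ResolutionOfSingularities.Theorems.HomologicalConductorNoZenoExcCurveLift
import Summits.ResolutionOfSingularities.ResolutionOfSingularities.Theorems.HomologicalConductorNoZenoMinResolutionFewest
import Summits.ResolutionOfSingularities.ResolutionOfSingularities.Theorems.HomologicalConductorNoZenoSplitCountDrop
import Summits.ResolutionOfSingularities.ResolutionOfSingularities.Theorems.HomologicalConductorNoZenoTreeSeparation
import Summits.ResolutionOfSingularities.ResolutionOfSingularities.Theorems.HomologicalConductorNoZenoIncidenceGraphAcyclic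
import Literature.AlgebraicGeometry.Resolution.RationalSurfaceSingularitiesBasic
import HarnessLib

/-!
# Crux `NoZenoR` (stmt-ResolutionOfSingularities-19943), slot 5 (B1) `stub_L1wCoreF3`: **seam2, ROUTE M** —
# the split count of the upstairs germ drops: `N^s(S′) ≤ N − 1`

OURS (cell res-hironaka, crux chain W4.4, lead res-L0-w44-lead-1 gen 9; RE-CUT «ROUTE M: minimal model dominated by the germ
resolution», STATUS 2026-08-27T20:38:37Z); nothing here is a statement of the manuscript under review (Hironaka 2017); AI-written,
weaker than expert review.  SUPPORT-level, counted 0.  Def-free.  FACTS as explicit binders (BRICK RULE): `Lipman1969_27_3_rat`,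
`Lipman1969_13_1_d_rat`, `Lipman1969_13_1_b_rat` (F-97 b), for the acyclicity brick), `Lipman1969_15_a`, `Lipman1969_4_1`.

THE STATEMENT (`hasSplitExcCurveCountLE_pred_routeM`), every geometric input BY SIGNATURE (suppliers named):
* the upstairs base `S` (rational, normal, 2-dim), a morphism `π : X → Spec S` with finitely many curves and `N^s(π) ≤ N`
  (BC-2c / BC-4, res-L0-w44-stub-2), `ρ : X¹ → X` with `ρ ≫ π` a resolution (o5 `NodeBlowup.isResolution_comp`), a set `NEW` of
  «node curves» of `ρ ≫ π` off which `ρ` is injective into the curves of `π` (o5 `excCurvePoints_eq_image_nodeBlowup` /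
  `Contraction.injOn_excCurvePoints_diff`), each node curve having two distinct old neighbours in `incidenceGraph (ρ ≫ π)`
  (o5 SUBDIVISION `subdivision_nodeBlowup` + GAP-N2 (NODE2-up): res-L0-w44-stub-4 (i), (F-a↑) (ii));
* a walk-connected set `C` of curves of `ρ ≫ π` missing at least one curve (seam1, res-L0-w44-stub-3: `C` = the curves over the point
  `𝔮` of the normalised blow-up, connected by Zariski, `P ≠ ∅` by p563075 and `P ∩ C = ∅` by p563971);
* the upstairs germ `S′` (rational: p535916; normal, 2-dim), its resolution `ψ : W → Spec S′` with a map `gW : W → X¹` carrying the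
  curves of `ψ` injectively into `C` (seam1), with weights `splitWeight ψ y ≤ splitWeight π (ρ (gW y))` off `NEW` (WEIGHT-up:
  `κ_S ⊆ κ_{S′} ⊆ κ(y) ≅ κ(E)`, p557965 + o5 FW), and the curves of `ψ` over `NEW` FIRST KIND over `S′` (stub-1 UP-5c) and
  ambient-REGULAR (node curves ≅ `ℙ¹`).
CONCLUSION: `HasSplitExcCurveCountLE S′ (N − 1)`.

THE PROOF (Route M): the minimal resolution `π_m : Y_m → Spec S′` exists (Lipman (4.1)) and `ψ` factors as `h ≫ π_m`; every curve
`yb` of `π_m` lifts to a curve `y` of `ψ` (stub-3 LIFT / DOM `mem_excCurvePoints_of_fac`) with the same weight (`splitWeight_eq_of_fac`);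
`gW y ∉ NEW` — a regular first-kind curve is never mapped onto a curve of the minimal model (`apply_notMem_excCurvePoints_of_firstKind`,
the lead's Case-A trilogy p568621/p569618/p570573); so `yb ↦ ρ (gW y)` maps the curves of `π_m` injectively and weight-non-increasingly
into the curves of `π`, and it MISSES the old curve outside `C` produced by G-comb on the ACYCLIC `incidenceGraph (ρ ≫ π)`
(`incidenceGraph_isAcyclic`, `IsAcyclic.exists_not_mem_of_walkConnected`); `hasSplitExcCurveCountLE_pred_of_mapsTo` concludes.

References: J. Lipman, *Rational singularities …*, Publ. Math. IHÉS 36 (1969), Thm. (4.1) (p. 204), Prop. (13.1) (p. 223), §15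
(p. 227), §24 (p. 258), Cor. (27.3) (p. 277) [`Lipman1969`].
-/

noncomputable section

-- single-problem summit: the doubled namespace component `ResolutionOfSingularities` is forced
set_option linter.dupNamespace false

namespace Summit.ResolutionOfSingularities.ResolutionOfSingularities.Theorems.NoZeno.ExcCount

open CategoryTheory AlgebraicGeometry TopologicalSpace IsLocalRing
open Literature.AlgebraicGeometry.Resolution Literature.AlgebraicGeometry.Motives

/-- **G-comb on the node-subdivided configuration**: if the incidence graph is acyclic, `C` is walk-connected, some curve lies outside
`C`, and every curve of `NEW` has two distinct neighbours outside `NEW`, then some curve OUTSIDE `NEW` lies outside `C`. [folklore] -/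
theorem exists_old_notMem_of_walkConnected {V : Type*} {G : SimpleGraph V} (hG : G.IsAcyclic) {Exc NEW C : Set V}
    (hnode : ∀ n ∈ NEW, ∃ a b : V, a ∈ Exc \ NEW ∧ b ∈ Exc \ NEW ∧ a ≠ b ∧ G.Adj n a ∧ G.Adj n b)
    (hC : ∀ x ∈ C, ∀ y ∈ C, ∃ p : G.Walk x y, ∀ v ∈ p.support, v ∈ C)
    (hmiss : ∃ η₀ ∈ Exc, η₀ ∉ C) :
    ∃ o ∈ Exc \ NEW, o ∉ C := by
  obtain ⟨η₀, hη₀, hη₀C⟩ := hmiss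
  by_cases hnew : η₀ ∈ NEW
  · obtain ⟨a, b, ha, hb, hab, hna, hnb⟩ := hnode η₀ hnew
    exact IsAcyclic.exists_not_mem_of_walkConnected hG (O := Exc \ NEW) (P := {η₀}) hC
      (Set.disjoint_singleton_left.mpr hη₀C) (Or.inr ⟨η₀, rfl, a, ha, b, hb, hab, hna, hnb⟩)
  · exact ⟨η₀, ⟨hη₀, hnew⟩, hη₀C⟩

variable {S : Type} [CommRing S] [IsNoetherianRing S] [IsLocalRing S] [IsDomain S] [IsIntegrallyClosed S]
  {X X1 : Scheme.{0}} [IsIntegral X1] [IsLocallyNoetherian X1]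
  {π : X ⟶ Spec (.of S)}
  {S' : Type} [CommRing S'] [IsNoetherianRing S'] [IsLocalRing S'] [IsDomain S'] [IsIntegrallyClosed S']
  {W : Scheme.{0}} [IsIntegral W] [IsLocallyNoetherian W]

/-- **seam2, ROUTE M: the split count of the upstairs germ drops.**  See the module docstring for the reading of every binder.
[cite: Lipman1969, Theorem (4.1) (p. 204), Corollary (27.3) (p. 277), Section 24 (p. 258)] -/
theorem hasSplitExcCurveCountLE_pred_routeM (h273 : Lipman1969_27_3_rat.{0}) (h131d : Lipman1969_13_1_d_rat.{0})
    (h131b : Lipman1969_13_1_b_rat.{0}) (h15a : Lipman1969_15_a.{0}) (h41 : Lipman1969_4_1.{0})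
    -- the upstairs base and its resolution `π` with `N^s(π) ≤ N`
    (hdim : ringKrullDim S = 2) (hS : HasRationalSingularity S)
    (hfin : (excCurvePoints π).Finite) {N : ℕ} (hN : splitExcCount π ≤ N)
    -- the node blow-up `ρ` and its node curves `NEW`
    (ρ : X1 ⟶ X) (hψ1 : IsResolution (ρ ≫ π)) (NEW : Set X1)
    (hρmaps : Set.MapsTo ρ.base (excCurvePoints (ρ ≫ π) \ NEW) (excCurvePoints π))
    (hρinj : Set.InjOn ρ.base (excCurvePoints (ρ ≫ π) \ NEW))
    (hnode : ∀ n ∈ NEW, ∃ a b : X1, a ∈ excCurvePoints (ρ ≫ π) \ NEW ∧ b ∈ excCurvePoints (ρ ≫ π) \ NEW ∧ a ≠ b ∧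
      (incidenceGraph (ρ ≫ π)).Adj n a ∧ (incidenceGraph (ρ ≫ π)).Adj n b)
    -- the curves `C` over the point `𝔮`: walk-connected, missing a curve
    (C : Set X1) (hCsub : C ⊆ excCurvePoints (ρ ≫ π))
    (hCconn : ∀ x ∈ C, ∀ y ∈ C, ∃ p : (incidenceGraph (ρ ≫ π)).Walk x y, ∀ v ∈ p.support, v ∈ C)
    (hCmiss : ∃ η₀ ∈ excCurvePoints (ρ ≫ π), η₀ ∉ C)
    -- the upstairs germ `S′`, its resolution `ψ` and the comparison map `gW`
    (hdim' : ringKrullDim S' = 2) (hS' : HasRationalSingularity S')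
    {ψ : W ⟶ Spec (.of S')} (hψ : IsResolution ψ) (gW : W ⟶ X1)
    (hgC : ∀ y ∈ excCurvePoints ψ, gW.base y ∈ C) (hginj : Set.InjOn gW.base (excCurvePoints ψ))
    (hw : ∀ y ∈ excCurvePoints ψ, gW.base y ∉ NEW → splitWeight ψ y ≤ splitWeight π (ρ.base (gW.base y)))
    (hfk : ∀ y ∈ excCurvePoints ψ, gW.base y ∈ NEW → h0 ψ (primeDivisorIdeal y ^ 2) = 3 * h0 ψ (primeDivisorIdeal y))
    (hreg : ∀ y ∈ excCurvePoints ψ, gW.base y ∈ NEW →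
      ∀ t : W, y ⤳ t → ¬ stalkIdeal (primeDivisorIdeal y) t ≤ (maximalIdeal (W.presheaf.stalk t)) ^ 2) :
    HasSplitExcCurveCountLE S' (N - 1) := by
  -- (0) the old curve missed by `C` (G-comb on the acyclic incidence graph of `ρ ≫ π`)
  have hG : (incidenceGraph (ρ ≫ π)).IsAcyclic := incidenceGraph_isAcyclic (ρ ≫ π) hdim hS hψ1 h131b h131d
  obtain ⟨o, ⟨hoexc, honew⟩, hoC⟩ := exists_old_notMem_of_walkConnected hG hnode hCconn hCmiss
  -- (1) the minimal resolution of the germ and the factorisation `ψ = h ≫ π_m`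
  obtain ⟨Y, πm, hmin⟩ := h41.exists_isMinimalResolution_Spec S' hdim' hS'
  obtain ⟨h, hfac⟩ := hmin.2 W ψ hψ
  subst hfac
  haveI : IsIntegral Y := hmin.1.isIntegral_source
  haveI : IsProper πm := hmin.1.isProper
  haveI : IsLocallyNoetherian Y := LocallyOfFiniteType.isLocallyNoetherian πm
  haveI : IsProper (h ≫ πm) := hψ.isProper
  have hbir : IsBirational h := isBirational_of_fac hψ.isBirational hmin.1.isBirational
  haveI : IsDominant h := hbir.isDominant
  -- (2) a set-theoretic section of `h` on points; it lifts curves to curves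
  have hsurj : Function.Surjective h.base := surjective_base_of_fac hψ.isBirational hmin.1.isBirational
  let φ₀ : Y → W := Function.surjInv hsurj
  have hφ₀ : ∀ yb, h.base (φ₀ yb) = yb := Function.surjInv_eq hsurj
  have hlift : ∀ yb ∈ excCurvePoints πm, φ₀ yb ∈ excCurvePoints (h ≫ πm) := fun yb hyb =>
    mem_excCurvePoints_of_fac hdim' hψ hmin.1 (by rw [hφ₀]; exact hyb)
  -- (3) lifted curves are OLD: a regular first-kind curve is never mapped onto a curve of the minimal model
  have hold : ∀ yb ∈ excCurvePoints πm, gW.base (φ₀ yb) ∈ excCurvePoints (ρ ≫ π) \ NEW := by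
    intro yb hyb
    have hy := hlift yb hyb
    refine ⟨hCsub (hgC _ hy), fun hnew => ?_⟩
    have := apply_notMem_excCurvePoints_of_firstKind h273 h131d h15a hdim' hS' hmin h hbir hψ hy
      (hfk _ hy hnew) (hreg _ hy hnew)
    rw [hφ₀] at this
    exact this hyb
  -- (4) the comparison map `φ : Y → X`, `yb ↦ ρ (gW y)`: into the curves of `π`, injective, weight-non-increasing
  let φ : Y → X := fun yb => ρ.base (gW.base (φ₀ yb))
  have hmaps : Set.MapsTo φ (excCurvePoints πm) (excCurvePoints π) := fun yb hyb => hρmaps (hold yb hyb)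
  have hinj : Set.InjOn φ (excCurvePoints πm) := by
    intro yb₁ h₁ yb₂ h₂ heq
    have e1 : gW.base (φ₀ yb₁) = gW.base (φ₀ yb₂) := hρinj (hold yb₁ h₁) (hold yb₂ h₂) heq
    have e2 : φ₀ yb₁ = φ₀ yb₂ := hginj (hlift yb₁ h₁) (hlift yb₂ h₂) e1
    rw [← hφ₀ yb₁, ← hφ₀ yb₂, e2]
  have hwt : ∀ yb ∈ excCurvePoints πm, splitWeight πm yb ≤ splitWeight π (φ yb) := by
    intro yb hyb
    have hy := hlift yb hyb
    have e := splitWeight_eq_of_fac hdim' hψ hmin.1 (ξ := φ₀ yb) (by rw [hφ₀]; exact hyb)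
    rw [hφ₀] at e
    rw [← e]
    exact hw _ hy (hold yb hyb).2
  -- (5) `φ` misses the old curve `ρ o`
  have hρo : ρ.base o ∈ excCurvePoints π := hρmaps ⟨hoexc, honew⟩
  have hmiss : ρ.base o ∉ φ '' excCurvePoints πm := by
    rintro ⟨yb, hyb, heq⟩
    have e1 : gW.base (φ₀ yb) = o := hρinj (hold yb hyb) ⟨hoexc, honew⟩ heq
    exact hoC (e1 ▸ hgC _ (hlift yb hyb))
  -- (6) the count drops
  exact hasSplitExcCurveCountLE_pred_of_mapsTo π πm φ hmin hfin hN hmaps hinj hwt hρo hmiss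

end Summit.ResolutionOfSingularities.ResolutionOfSingularities.Theorems.NoZeno.ExcCount

end
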